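import Summits.KontsevichZagierPeriods.KontsevichZagierPeriods.Theses.GaussManinCertificates
import Literature.ModelTheory.ExponentialFields.CylindricalDecompositionProofs
import Literature.NumberTheory.Transcendental.KZLogCalculusProofs

/-!
# Birth skeleton of piece `SemialgebraicFibreRuns` (typed decomposition of crux `KZStokes`, stmt-KontsevichZagierPeriods-3012)

`SemialgebraicFibreRuns` (a bounded `ℚ`-semialgebraic `σ ⊆ ℝⁿ⁺¹` is, off a null set, a finite disjoint
union of open run bands whose fibres are intervals of `σ_x` with end points on `frontier σ_x`) from the
PROVED adapted cylindrical decomposition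
(`Literature.ModelTheory.ExponentialFields.IsSemialgebraic.exists_cylindricalDecomposition_holds`,
corollary `….exists_cylindricalDecomposition.exists_fibre_eq`) and two stubs:

* `stub_cellRuns` (the combinatorial heart, size M) — over ONE base set `S` on which the fibres of `σ`
  are uniformly `⋃_{j∈G} {ξ_j x} ∪ ⋃_{j∈B} (ξ_{j−1} x, ξ_j x)` for strictly increasing `ℚ`-semialgebraic
  sections `ξ` and FIXED `G`, `B` (the output of `exists_fibre_eq` at a cell): merge each maximal chain
  band–graph–band of members of `σ` into one run `(ξ_i, ξ_k)` over `S`; its end sections are frontier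
  points of the fibre; boundedness of `σ` excludes the unbounded bands; the remainder over `S` is a finite
  union of graphs (null, `KZ.volume_graph_eq_zero`);
* `stub_assembleRuns` (size S/M) — flatten the per-cell run families over a finite partition of `ℝⁿ` into
  ℚ-semialgebraic cells into one `Fin J`-indexed family for `σ` (disjointness across cells from disjoint
  cylinders; the remainders add up to a null set);
* `SemialgebraicFibreRuns_of_subs` — composition (proved): CAD ⇒ per-cell data ⇒ `stub_cellRuns` ⇒
  `stub_assembleRuns`.

Sorries ONLY in the two stubs. [Basu–Pollack–Roy 2006, Thm. 5.6 / Cor. 5.7]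
-/

noncomputable section

open MeasureTheory Set
open Literature.ModelTheory.ExponentialFields
open Literature.NumberTheory.Transcendental

-- `Summit.KontsevichZagierPeriods.KontsevichZagierPeriods.…` is the tree's mandated layout (single-conjunct summit).
set_option linter.dupNamespace false

namespace Summit.KontsevichZagierPeriods.KontsevichZagierPeriods.Cruxes.KZStokes.FibreRunsBirth

/-- Piece `SemialgebraicFibreRuns` of the typed decomposition of `KZStokes` (verbatim).
[cite: BasuPollackRoy2006, Cor. 5.7] -/
def SemialgebraicFibreRuns : Prop :=
  ∀ (n : ℕ) (σ : Set (Fin (n + 1) → ℝ)), Literature.ModelTheory.ExponentialFields.IsSemialgebraic ℚ σ → Bornology.IsBounded σ → ∃ (J : ℕ) (S : Fin J → Set (Fin n → ℝ)) (a b : Fin J → (Fin n → ℝ) → ℝ) (R : Fin J → Set (Fin (n + 1) → ℝ)), (∀ j, Literature.ModelTheory.ExponentialFields.IsSemialgebraic ℚ (S j)) ∧ (∀ j, Literature.NumberTheory.Transcendental.IsSemialgebraicFunOn ℚ (S j) (a j)) ∧ (∀ j, Literature.NumberTheory.Transcendental.IsSemialgebraicFunOn ℚ (S j) (b j)) ∧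 (∀ j, ∀ x ∈ S j, a j x < b j x) ∧ (∀ j, R j = {z : Fin (n + 1) → ℝ | Fin.init z ∈ S j ∧ z (Fin.last n) ∈ Set.Ioo (a j (Fin.init z)) (b j (Fin.init z))}) ∧ (∀ j, Literature.ModelTheory.ExponentialFields.IsSemialgebraic ℚ (R j)) ∧ (∀ j, ∀ x ∈ S j, Set.Ioo (a j x) (b j x) ⊆ {s : ℝ | (Fin.snoc x s : Fin (n + 1) → ℝ) ∈ σ}) ∧ (∀ j, ∀ x ∈ S j, a j x ∈ frontier {s : ℝ | (Fin.snoc x s : Fin (n + 1) → ℝ) ∈ σ} ∧ b j x ∈ frontier {s : ℝ | (Fin.snoc x s : Fin (n + 1) → ℝ) ∈ σ}) ∧ (Pairwise fun i j => Disjoint (R i) (R j)) ∧ MeasureTheory.volume (σ \ ⋃ j, R j) = 0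

/-- STUB 1 (combinatorial heart): maximal runs over ONE base set with a uniform fibre description.
[cite: BasuPollackRoy2006, Cor. 5.7] -/
theorem stub_cellRuns :
    ∀ (n : ℕ) (σ : Set (Fin (n + 1) → ℝ)) (S : Set (Fin n → ℝ)) (l : ℕ) (ξ : Fin l → (Fin n → ℝ) → ℝ)
      (G : Finset (Fin l)) (B : Finset (Fin (l + 1))),
      Literature.ModelTheory.ExponentialFields.IsSemialgebraic ℚ σ → Bornology.IsBounded σ →
      Literature.ModelTheory.ExponentialFields.IsSemialgebraic ℚ S →
      (∀ i, Literature.NumberTheory.Transcendental.IsSemialgebraicFunOn ℚ S (ξ i)) →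
      (∀ x ∈ S, StrictMono fun i => ξ i x) →
      (∀ j ∈ B, Literature.ModelTheory.ExponentialFields.bandOver S ξ j ⊆ σ) →
      (∀ x ∈ S, {t : ℝ | (Fin.snoc x t : Fin (n + 1) → ℝ) ∈ σ} =
        (⋃ j ∈ G, {ξ j x}) ∪ ⋃ j ∈ B, {t : ℝ | Literature.ModelTheory.ExponentialFields.bandLower ξ j x < t ∧
          (t : EReal) < Literature.ModelTheory.ExponentialFields.bandUpper ξ j x}) →
      ∃ (J : ℕ) (a b : Fin J → (Fin n → ℝ) → ℝ) (R : Fin J → Set (Fin (n + 1) → ℝ)),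
        (∀ j, Literature.NumberTheory.Transcendental.IsSemialgebraicFunOn ℚ S (a j)) ∧
        (∀ j, Literature.NumberTheory.Transcendental.IsSemialgebraicFunOn ℚ S (b j)) ∧
        (∀ j, ∀ x ∈ S, a j x < b j x) ∧
        (∀ j, R j = {z : Fin (n + 1) → ℝ | Fin.init z ∈ S ∧
          z (Fin.last n) ∈ Set.Ioo (a j (Fin.init z)) (b j (Fin.init z))}) ∧
        (∀ j, Literature.ModelTheory.ExponentialFields.IsSemialgebraic ℚ (R j)) ∧
        (∀ j, ∀ x ∈ S, Set.Ioo (a j x) (b j x) ⊆ {s : ℝ | (Fin.snoc x s : Fin (n + 1) → ℝ) ∈ σ}) ∧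
        (∀ j, ∀ x ∈ S, a j x ∈ frontier {s : ℝ | (Fin.snoc x s : Fin (n + 1) → ℝ) ∈ σ} ∧
          b j x ∈ frontier {s : ℝ | (Fin.snoc x s : Fin (n + 1) → ℝ) ∈ σ}) ∧
        (Pairwise fun i j => Disjoint (R i) (R j)) ∧
        MeasureTheory.volume ((σ ∩ {z : Fin (n + 1) → ℝ | Fin.init z ∈ S}) \ ⋃ j, R j) = 0 := by
  sorry

/-- STUB 2 (flattening): per-cell run families over a finite partition into `ℚ`-semialgebraic cells give
a run family for `σ`. [folklore] -/
theorem stub_assembleRuns :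
    ∀ (n : ℕ) (σ : Set (Fin (n + 1) → ℝ)) (𝒮 : Finset (Set (Fin n → ℝ))),
      Setoid.IsPartition (𝒮 : Set (Set (Fin n → ℝ))) →
      (∀ S ∈ 𝒮, Literature.ModelTheory.ExponentialFields.IsSemialgebraic ℚ S) →
      (∀ S ∈ 𝒮, ∃ (J : ℕ) (a b : Fin J → (Fin n → ℝ) → ℝ) (R : Fin J → Set (Fin (n + 1) → ℝ)),
        (∀ j, Literature.NumberTheory.Transcendental.IsSemialgebraicFunOn ℚ S (a j)) ∧
        (∀ j, Literature.NumberTheory.Transcendental.IsSemialgebraicFunOn ℚ S (b j)) ∧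
        (∀ j, ∀ x ∈ S, a j x < b j x) ∧
        (∀ j, R j = {z : Fin (n + 1) → ℝ | Fin.init z ∈ S ∧
          z (Fin.last n) ∈ Set.Ioo (a j (Fin.init z)) (b j (Fin.init z))}) ∧
        (∀ j, Literature.ModelTheory.ExponentialFields.IsSemialgebraic ℚ (R j)) ∧
        (∀ j, ∀ x ∈ S, Set.Ioo (a j x) (b j x) ⊆ {s : ℝ | (Fin.snoc x s : Fin (n + 1) → ℝ) ∈ σ}) ∧
        (∀ j, ∀ x ∈ S, a j x ∈ frontier {s : ℝ | (Fin.snoc x s : Fin (n + 1) → ℝ) ∈ σ} ∧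
          b j x ∈ frontier {s : ℝ | (Fin.snoc x s : Fin (n + 1) → ℝ) ∈ σ}) ∧
        (Pairwise fun i j => Disjoint (R i) (R j)) ∧
        MeasureTheory.volume ((σ ∩ {z : Fin (n + 1) → ℝ | Fin.init z ∈ S}) \ ⋃ j, R j) = 0) →
      ∃ (J : ℕ) (S : Fin J → Set (Fin n → ℝ)) (a b : Fin J → (Fin n → ℝ) → ℝ) (R : Fin J → Set (Fin (n + 1) → ℝ)),
        (∀ j, Literature.ModelTheory.ExponentialFields.IsSemialgebraic ℚ (S j)) ∧
        (∀ j, Literature.NumberTheory.Transcendental.IsSemialgebraicFunOn ℚ (S j) (a j)) ∧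
        (∀ j, Literature.NumberTheory.Transcendental.IsSemialgebraicFunOn ℚ (S j) (b j)) ∧
        (∀ j, ∀ x ∈ S j, a j x < b j x) ∧
        (∀ j, R j = {z : Fin (n + 1) → ℝ | Fin.init z ∈ S j ∧
          z (Fin.last n) ∈ Set.Ioo (a j (Fin.init z)) (b j (Fin.init z))}) ∧
        (∀ j, Literature.ModelTheory.ExponentialFields.IsSemialgebraic ℚ (R j)) ∧
        (∀ j, ∀ x ∈ S j, Set.Ioo (a j x) (b j x) ⊆ {s : ℝ | (Fin.snoc x s : Fin (n + 1) → ℝ) ∈ σ}) ∧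
        (∀ j, ∀ x ∈ S j, a j x ∈ frontier {s : ℝ | (Fin.snoc x s : Fin (n + 1) → ℝ) ∈ σ} ∧
          b j x ∈ frontier {s : ℝ | (Fin.snoc x s : Fin (n + 1) → ℝ) ∈ σ}) ∧
        (Pairwise fun i j => Disjoint (R i) (R j)) ∧
        MeasureTheory.volume (σ \ ⋃ j, R j) = 0 := by
  sorry

/-- **Composition**: the adapted cylindrical decomposition (PROVED in the tree) feeds `stub_cellRuns`
cell by cell, and `stub_assembleRuns` flattens. [cite: BasuPollackRoy2006, Cor. 5.7] -/
theorem SemialgebraicFibreRuns_of_subs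
    (h1 : ∀ (n : ℕ) (σ : Set (Fin (n + 1) → ℝ)) (S : Set (Fin n → ℝ)) (l : ℕ) (ξ : Fin l → (Fin n → ℝ) → ℝ)
      (G : Finset (Fin l)) (B : Finset (Fin (l + 1))),
      Literature.ModelTheory.ExponentialFields.IsSemialgebraic ℚ σ → Bornology.IsBounded σ →
      Literature.ModelTheory.ExponentialFields.IsSemialgebraic ℚ S →
      (∀ i, Literature.NumberTheory.Transcendental.IsSemialgebraicFunOn ℚ S (ξ i)) →
      (∀ x ∈ S, StrictMono fun i => ξ i x) →
      (∀ j ∈ B, Literature.ModelTheory.ExponentialFields.bandOver S ξ j ⊆ σ) →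
      (∀ x ∈ S, {t : ℝ | (Fin.snoc x t : Fin (n + 1) → ℝ) ∈ σ} =
        (⋃ j ∈ G, {ξ j x}) ∪ ⋃ j ∈ B, {t : ℝ | Literature.ModelTheory.ExponentialFields.bandLower ξ j x < t ∧
          (t : EReal) < Literature.ModelTheory.ExponentialFields.bandUpper ξ j x}) →
      ∃ (J : ℕ) (a b : Fin J → (Fin n → ℝ) → ℝ) (R : Fin J → Set (Fin (n + 1) → ℝ)),
        (∀ j, Literature.NumberTheory.Transcendental.IsSemialgebraicFunOn ℚ S (a j)) ∧
        (∀ j, Literature.NumberTheory.Transcendental.IsSemialgebraicFunOn ℚ S (b j)) ∧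
        (∀ j, ∀ x ∈ S, a j x < b j x) ∧
        (∀ j, R j = {z : Fin (n + 1) → ℝ | Fin.init z ∈ S ∧
          z (Fin.last n) ∈ Set.Ioo (a j (Fin.init z)) (b j (Fin.init z))}) ∧
        (∀ j, Literature.ModelTheory.ExponentialFields.IsSemialgebraic ℚ (R j)) ∧
        (∀ j, ∀ x ∈ S, Set.Ioo (a j x) (b j x) ⊆ {s : ℝ | (Fin.snoc x s : Fin (n + 1) → ℝ) ∈ σ}) ∧
        (∀ j, ∀ x ∈ S, a j x ∈ frontier {s : ℝ | (Fin.snoc x s : Fin (n + 1) → ℝ) ∈ σ} ∧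
          b j x ∈ frontier {s : ℝ | (Fin.snoc x s : Fin (n + 1) → ℝ) ∈ σ}) ∧
        (Pairwise fun i j => Disjoint (R i) (R j)) ∧
        MeasureTheory.volume ((σ ∩ {z : Fin (n + 1) → ℝ | Fin.init z ∈ S}) \ ⋃ j, R j) = 0)
    (h2 : ∀ (n : ℕ) (σ : Set (Fin (n + 1) → ℝ)) (𝒮 : Finset (Set (Fin n → ℝ))),
      Setoid.IsPartition (𝒮 : Set (Set (Fin n → ℝ))) →
      (∀ S ∈ 𝒮, Literature.ModelTheory.ExponentialFields.IsSemialgebraic ℚ S) →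
      (∀ S ∈ 𝒮, ∃ (J : ℕ) (a b : Fin J → (Fin n → ℝ) → ℝ) (R : Fin J → Set (Fin (n + 1) → ℝ)),
        (∀ j, Literature.NumberTheory.Transcendental.IsSemialgebraicFunOn ℚ S (a j)) ∧
        (∀ j, Literature.NumberTheory.Transcendental.IsSemialgebraicFunOn ℚ S (b j)) ∧
        (∀ j, ∀ x ∈ S, a j x < b j x) ∧
        (∀ j, R j = {z : Fin (n + 1) → ℝ | Fin.init z ∈ S ∧
          z (Fin.last n) ∈ Set.Ioo (a j (Fin.init z)) (b j (Fin.init z))}) ∧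
        (∀ j, Literature.ModelTheory.ExponentialFields.IsSemialgebraic ℚ (R j)) ∧
        (∀ j, ∀ x ∈ S, Set.Ioo (a j x) (b j x) ⊆ {s : ℝ | (Fin.snoc x s : Fin (n + 1) → ℝ) ∈ σ}) ∧
        (∀ j, ∀ x ∈ S, a j x ∈ frontier {s : ℝ | (Fin.snoc x s : Fin (n + 1) → ℝ) ∈ σ} ∧
          b j x ∈ frontier {s : ℝ | (Fin.snoc x s : Fin (n + 1) → ℝ) ∈ σ}) ∧
        (Pairwise fun i j => Disjoint (R i) (R j)) ∧
        MeasureTheory.volume ((σ ∩ {z : Fin (n + 1) → ℝ | Fin.init z ∈ S}) \ ⋃ j, R j) = 0) →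
      ∃ (J : ℕ) (S : Fin J → Set (Fin n → ℝ)) (a b : Fin J → (Fin n → ℝ) → ℝ) (R : Fin J → Set (Fin (n + 1) → ℝ)),
        (∀ j, Literature.ModelTheory.ExponentialFields.IsSemialgebraic ℚ (S j)) ∧
        (∀ j, Literature.NumberTheory.Transcendental.IsSemialgebraicFunOn ℚ (S j) (a j)) ∧
        (∀ j, Literature.NumberTheory.Transcendental.IsSemialgebraicFunOn ℚ (S j) (b j)) ∧
        (∀ j, ∀ x ∈ S j, a j x < b j x) ∧
        (∀ j, R j = {z : Fin (n + 1) → ℝ | Fin.init z ∈ S j ∧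
          z (Fin.last n) ∈ Set.Ioo (a j (Fin.init z)) (b j (Fin.init z))}) ∧
        (∀ j, Literature.ModelTheory.ExponentialFields.IsSemialgebraic ℚ (R j)) ∧
        (∀ j, ∀ x ∈ S j, Set.Ioo (a j x) (b j x) ⊆ {s : ℝ | (Fin.snoc x s : Fin (n + 1) → ℝ) ∈ σ}) ∧
        (∀ j, ∀ x ∈ S j, a j x ∈ frontier {s : ℝ | (Fin.snoc x s : Fin (n + 1) → ℝ) ∈ σ} ∧
          b j x ∈ frontier {s : ℝ | (Fin.snoc x s : Fin (n + 1) → ℝ) ∈ σ}) ∧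
        (Pairwise fun i j => Disjoint (R i) (R j)) ∧
        MeasureTheory.volume (σ \ ⋃ j, R j) = 0) :
    SemialgebraicFibreRuns := by
  intro n σ hσ hbdd
  obtain ⟨𝒮, l, ξ, h𝒮, -, hsa, hmono, -, hGB⟩ :=
    IsSemialgebraic.exists_cylindricalDecomposition.exists_fibre_eq
      (IsSemialgebraic.exists_cylindricalDecomposition_holds (k := ℚ)) hσ
  refine h2 n σ 𝒮 h𝒮.isPartition h𝒮.isSemialgebraic fun S hS => ?_
  obtain ⟨G, B, -, hB, hfib⟩ := hGB S hS
  exact h1 n σ S (l S) (ξ S) G B hσ hbdd (h𝒮.isSemialgebraic S hS) (hsa S hS) (hmono S hS) hB hfib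

/-- `SemialgebraicFibreRuns` from the two stubs. [cite: BasuPollackRoy2006, Cor. 5.7] -/
theorem SemialgebraicFibreRuns_of : SemialgebraicFibreRuns :=
  SemialgebraicFibreRuns_of_subs stub_cellRuns stub_assembleRuns

end Summit.KontsevichZagierPeriods.KontsevichZagierPeriods.Cruxes.KZStokes.FibreRunsBirth
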